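/-
Copyright (c) 2026 the pub-hodgecm-mathlib formalisation cell (harness21).  Prover seat hodgecm-mathlib-A-p17 (g26), P6 «MOD programme»,
organ (ν7) of the G1c «ROOF REDUCTION» remainder (turnkey form of (ν6)); 2026-09-01.
-/
import Literature.AlgebraicGeometry.AbelianSchemes.AbelianSchemeHomReductionAlongStage
import HarnessLib

/-!
# REDUCTION OF A HOMOMORPHISM between fibre tuples at two `Ω`-points of a proper model — TURNKEY FORM
# (the finite Dedekind stage is PRODUCED, not assumed; [SerreTate1968] §1, [EGAIV3] 8.8.2, [BoschLutkebohmertRaynaud1990] §1.2 Prop. 8, §7.3 Prop. 6)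

Topic `AlgebraicGeometry/AbelianSchemes`, namespace `Literature.AlgebraicGeometry.AbelianSchemes.AbelianSchemeOver`.  THEOREMS ONLY
(no definition, no named fact, no instance, no notation, no `sorry`).  Cell `hodgecm-mathlib` (D-0151), F0∕P6 «MOD», organ **(ν7)** = the
TURNKEY form of ★ (ν6) `exists_stage_hom_reduction`: the inputs are ONLY the proper model `𝓨` (locally of finite type over `𝓞ᵥ`), the two
abelian schemes `𝒜, 𝒞 → 𝓨`, the two points `x, x″ ∈ Y(Ω)` and the `Ω`-homomorphism `u` between the fibre tuples; the finite DEDEKIND STAGE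
(an abstract `D` with fraction field `L`, `g : 𝓞ᵥ → D`, `h : D → R = 𝒪_{Ω̄}`, `h ∘ g = (𝓞ᵥ → R)`, `L` perfect, `Ω ⊇ L` algebraic; witness: ★ (ν4)
`exists_finiteStage_comp_eq_pair` + ★ (ν1) `isDedekindDomain_integralClosure` ∕ `isFractionRing_integralClosure` + ★ (ν3)
`specGenericPoint_comp_specMap_eq_of_coe_eq`) and the stage points `z, z″` UNDER the two integral points are PART OF THE CONCLUSION — then
verbatim the conclusions of ★ (ν6) (refined stage `D′ = integralClosure D L′`, homomorphism `U`, point equalities for the ★ (ν6) §1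
along-stage isomorphisms, `U_{a′} = (E 𝒜)⁻¹ ≫ u ≫ (E″ 𝒞)`, uniqueness, isogeny transfer).  The stage `D` is kept ABSTRACT in the statement
(nested `integralClosure (integralClosure …)` towers make instance synthesis time out — (ν6) INDEX memo §3).

HONEST LABEL: HC_CM is proved only modulo the cell's 2 remaining named inputs (hLiu418 24832, h413 24833) until rung 0 closes; generic capital on
`--supports stmt-HodgeConjecture-24832`, pays no letter.

## References
* [SerreTate1968] J.-P. Serre, J. Tate, *Good reduction of abelian varieties*, Ann. of Math. 88 (1968), §1.
* [EGAIV3] A. Grothendieck, J. Dieudonné, EGA IV₃ (1966), Thm. 8.8.2 (i).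
* [BoschLutkebohmertRaynaud1990] S. Bosch, W. Lütkebohmert, M. Raynaud, *Néron Models* (1990), §1.2 Prop. 8, §7.3 Prop. 6.
* [NeukirchANT1999] J. Neukirch, *Algebraic Number Theory* (1999), Ch. II (4.8).
* [MumfordFogartyKirwan1994] D. Mumford, J. Fogarty, F. Kirwan, *GIT*, 3rd ed., Ch. 7 §2 Def. 7.2 (p. 129).
-/

set_option autoImplicit false

noncomputable section

set_option backward.isDefEq.respectTransparency false

open CategoryTheory CategoryTheory.Limits AlgebraicGeometry
open scoped MonObj CategoryTheory.Obj NumberField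
open Literature.AlgebraicGeometry.Motives
open IsDedekindDomain IsDedekindDomain.HeightOneSpectrum ValuativeRel
open Literature.NumberTheory.EllipticCurves (genericFibre specGenericPoint)
open Literature.NumberTheory.GaloisRepresentations (closureValuationSubring)
open Literature.NumberTheory.DiophantineGeometry

namespace Literature.AlgebraicGeometry.AbelianSchemes

namespace AbelianSchemeOver

variable {K : Type} [Field K] [NumberField K] {v : HeightOneSpectrum (𝓞 K)} {Y : SchemeOver K}
  (𝓨 : IntegralModel (valuationSubringAtPrime K v) K Y) [IsProper 𝓨.total.hom]
  (𝒜 𝒞 : AbelianSchemeOver 𝓨.total.left) (x x'' : AlgPoints Y (AlgebraicClosure (v.adicCompletion K)))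

/-- **REDUCTION OF A HOMOMORPHISM BETWEEN FIBRE TUPLES AT TWO `Ω`-POINTS — TURNKEY.**  For a proper integral model `𝓨` of `Y` at `v` (locally
of finite type over `𝓞ᵥ`), abelian schemes `𝒜, 𝒞 → 𝓨`, points `x, x″ ∈ Y(Ω)` (`Ω = \overline{K_v}`, `R = 𝒪_{Ω̄}` = ★ `closureValuationSubring`) and
a homomorphism `u` of abelian varieties over `Ω` from the fibre of `𝒜|_Y` at `x` to the fibre of `𝒞|_Y` at `x″`: there are a finite DEDEKIND
STAGE `g : 𝓞ᵥ → D → R` (`h ∘ g = (𝓞ᵥ → R)`, fraction field `L` perfect with `Ω ⊇ L` algebraic, `ha`) with stage points `z, z″ : Spec D → 𝓨`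
under the two integral points (`hz`, `hz″`) — ★ (ν4) `exists_finiteStage_comp_eq_pair` — and then everything ★ (ν6) `exists_stage_hom_reduction`
delivers: refined stage `D′ = integralClosure D L′ → R`, a HOMOMORPHISM `U : (𝒜_z)_{D′} → (𝒞_{z″})_{D′}` over `Spec D′`, the point equalities for
the along-stage isomorphisms (★ (ν6) §1), `U_{a′} = (E 𝒜)⁻¹ ≫ u ≫ (E″ 𝒞)`, uniqueness of `U` given its `Ω`-fibre, and: `u` an isogeny ⇒ every
fibre of `U` over `Spec D′` an isogeny.  [cite: SerreTate1968, §1] [cite: EGAIV3, Thm. 8.8.2 (i)]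
[cite: BoschLutkebohmertRaynaud1990, §1.2 Prop. 8 and §7.3 Prop. 6 (p. 180)] [cite: MumfordFogartyKirwan1994, Ch. 7 §2 Definition 7.2 (p. 129)] -/
theorem exists_stage_hom_reduction_turnkey
    (u : ((𝒜.baseChange (𝓨.genericIso'.inv.left ≫ pullback.fst 𝓨.total.hom (specGenericPoint (valuationSubringAtPrime K v) K))).fibre
            x.left).toAbelianVariety ⟶
         ((𝒞.baseChange (𝓨.genericIso'.inv.left ≫ pullback.fst 𝓨.total.hom (specGenericPoint (valuationSubringAtPrime K v) K))).fibre
            x''.left).toAbelianVariety) :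
    ∃ (D : Type) (_ : CommRing D) (_ : IsDedekindDomain D) (L : Type) (_ : Field L) (_ : Algebra D L) (_ : IsFractionRing D L)
      (_ : PerfectField L) (_ : Algebra L (AlgebraicClosure (v.adicCompletion K)))
      (_ : Algebra.IsAlgebraic L (AlgebraicClosure (v.adicCompletion K)))
      (g : valuationSubringAtPrime K v →+* D) (h : D →+* closureValuationSubring (v.adicCompletion K))
      (_hh : ∀ d, ((h d : closureValuationSubring (v.adicCompletion K)) : AlgebraicClosure (v.adicCompletion K)) =
        algebraMap L (AlgebraicClosure (v.adicCompletion K)) (algebraMap D L d))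
      (_hg : h.comp g = toClosureValuationSubring v)
      (_ha : Spec.map (CommRingCat.ofHom (algebraMap L (AlgebraicClosure (v.adicCompletion K)))) ≫ specGenericPoint D L =
        specGenericPoint (closureValuationSubring (v.adicCompletion K)) (AlgebraicClosure (v.adicCompletion K)) ≫
          Spec.map (CommRingCat.ofHom h))
      (z z'' : Over.mk (Spec.map (CommRingCat.ofHom g)) ⟶ 𝓨.total)
      (_hz : Spec.map (CommRingCat.ofHom h) ≫ z.left =
        (extendPoint (closureValuationSubring (v.adicCompletion K)) (toClosureValuationSubring v) 𝓨.total (𝓨.modelPointsEquiv.symm x)).left)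
      (_hz'' : Spec.map (CommRingCat.ofHom h) ≫ z''.left =
        (extendPoint (closureValuationSubring (v.adicCompletion K)) (toClosureValuationSubring v) 𝓨.total (𝓨.modelPointsEquiv.symm x'')).left)
      (L' : Type) (_ : Field L') (_ : Algebra L L') (_ : Algebra D L') (_ : IsScalarTower D L L') (_ : Module.Finite L L')
      (χ : L' →ₐ[L] AlgebraicClosure (v.adicCompletion K))
      (h' : integralClosure D L' →+* closureValuationSubring (v.adicCompletion K))
      (U : ((𝒜.baseChange z.left).baseChange (Spec.map (CommRingCat.ofHom (algebraMap D (integralClosure D L'))))).X ⟶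
           ((𝒞.baseChange z''.left).baseChange (Spec.map (CommRingCat.ofHom (algebraMap D (integralClosure D L'))))).X)
      (_ : IsMonHom U)
      (hpt : x.left ≫ (𝓨.genericIso'.inv.left ≫ pullback.fst 𝓨.total.hom (specGenericPoint (valuationSubringAtPrime K v) K)) =
        (specGenericPoint (closureValuationSubring (v.adicCompletion K)) (AlgebraicClosure (v.adicCompletion K)) ≫
          Spec.map (CommRingCat.ofHom h)) ≫ z.left)
      (hpt'' : x''.left ≫ (𝓨.genericIso'.inv.left ≫ pullback.fst 𝓨.total.hom (specGenericPoint (valuationSubringAtPrime K v) K)) =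
        (specGenericPoint (closureValuationSubring (v.adicCompletion K)) (AlgebraicClosure (v.adicCompletion K)) ≫
          Spec.map (CommRingCat.ofHom h)) ≫ z''.left)
      (e : (specGenericPoint (closureValuationSubring (v.adicCompletion K)) (AlgebraicClosure (v.adicCompletion K)) ≫
            Spec.map (CommRingCat.ofHom h')) ≫ Spec.map (CommRingCat.ofHom (algebraMap D (integralClosure D L'))) =
          specGenericPoint (closureValuationSubring (v.adicCompletion K)) (AlgebraicClosure (v.adicCompletion K)) ≫
            Spec.map (CommRingCat.ofHom h))
      (_hspt : (𝓨.geomReductionMap x).left ≫ pullback.fst 𝓨.total.hom (specResidueField v) =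
        (((geomClosedPointIsoSpecResidueField v).inv.left ≫
          (specRingHomι (closureValuationSubring (v.adicCompletion K)) (toClosureValuationSubring v)
            (IsLocalRing.residue (closureValuationSubring (v.adicCompletion K)))).left) ≫ Spec.map (CommRingCat.ofHom h)) ≫ z.left)
      (_hspt'' : (𝓨.geomReductionMap x'').left ≫ pullback.fst 𝓨.total.hom (specResidueField v) =
        (((geomClosedPointIsoSpecResidueField v).inv.left ≫
          (specRingHomι (closureValuationSubring (v.adicCompletion K)) (toClosureValuationSubring v)
            (IsLocalRing.residue (closureValuationSubring (v.adicCompletion K)))).left) ≫ Spec.map (CommRingCat.ofHom h)) ≫ z''.left)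
      (_et : (((geomClosedPointIsoSpecResidueField v).inv.left ≫
          (specRingHomι (closureValuationSubring (v.adicCompletion K)) (toClosureValuationSubring v)
            (IsLocalRing.residue (closureValuationSubring (v.adicCompletion K)))).left) ≫ Spec.map (CommRingCat.ofHom h')) ≫
            Spec.map (CommRingCat.ofHom (algebraMap D (integralClosure D L'))) =
          ((geomClosedPointIsoSpecResidueField v).inv.left ≫
          (specRingHomι (closureValuationSubring (v.adicCompletion K)) (toClosureValuationSubring v)
            (IsLocalRing.residue (closureValuationSubring (v.adicCompletion K)))).left) ≫ Spec.map (CommRingCat.ofHom h)),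
      Function.Injective χ ∧
      (∀ x_1, ((h' x_1 : closureValuationSubring (v.adicCompletion K)) : AlgebraicClosure (v.adicCompletion K)) = χ (x_1 : L')) ∧
      h'.comp (algebraMap D (integralClosure D L')) = h ∧
      IsDedekindDomain (integralClosure D L') ∧ IsFractionRing (integralClosure D L') L' ∧
      -- the `Ω`-fibre of `U` IS `u`, through the along-stage isomorphisms of §1
      fibreHom U (specGenericPoint (closureValuationSubring (v.adicCompletion K)) (AlgebraicClosure (v.adicCompletion K)) ≫
          Spec.map (CommRingCat.ofHom h')) =
        (𝒜.fibreBaseChangeIso _ x.left ≪≫ 𝒜.fibreCongrPtIso hpt ≪≫ (𝒜.fibreBaseChangeIso z.left _).symm ≪≫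
            ((𝒜.baseChange z.left).fibreCongrPtIso e).symm ≪≫ ((𝒜.baseChange z.left).fibreBaseChangeIso _ _).symm).inv ≫ u ≫
        (𝒞.fibreBaseChangeIso _ x''.left ≪≫ 𝒞.fibreCongrPtIso hpt'' ≪≫ (𝒞.fibreBaseChangeIso z''.left _).symm ≪≫
            ((𝒞.baseChange z''.left).fibreCongrPtIso e).symm ≪≫ ((𝒞.baseChange z''.left).fibreBaseChangeIso _ _).symm).hom ∧
      -- uniqueness of `U` given its `Ω`-fibre
      (∀ U' : ((𝒜.baseChange z.left).baseChange (Spec.map (CommRingCat.ofHom (algebraMap D (integralClosure D L'))))).X ⟶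
           ((𝒞.baseChange z''.left).baseChange (Spec.map (CommRingCat.ofHom (algebraMap D (integralClosure D L'))))).X,
        (Over.pullback (specGenericPoint (closureValuationSubring (v.adicCompletion K)) (AlgebraicClosure (v.adicCompletion K)) ≫
            Spec.map (CommRingCat.ofHom h'))).map U' =
          (Over.pullback (specGenericPoint (closureValuationSubring (v.adicCompletion K)) (AlgebraicClosure (v.adicCompletion K)) ≫
            Spec.map (CommRingCat.ofHom h'))).map U → U' = U) ∧
      -- isogenies reduce to isogenies (every fibre over the refined stage)
      (AbelianVariety.IsIsogeny u → ∀ {k : Type} [Field k] (tt : Spec (.of k) ⟶ Spec (.of (integralClosure D L'))),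
        AbelianVariety.IsIsogeny (fibreHom U tt)) := by
  -- the common finite stage under the two integral points (★ (ν4))
  have H := exists_finiteStage_comp_eq_pair v 𝓨.total 𝓨.total
    (extendPoint (closureValuationSubring (v.adicCompletion K)) (toClosureValuationSubring v) 𝓨.total (𝓨.modelPointsEquiv.symm x))
    (extendPoint (closureValuationSubring (v.adicCompletion K)) (toClosureValuationSubring v) 𝓨.total (𝓨.modelPointsEquiv.symm x''))
  obtain ⟨L, hL, h, z, z'', w, hh, -, hcomp, hz, hz'', -, -⟩ := H
  haveI := hL
  haveI : CharZero (v.adicCompletion K) := charZero_of_injective_algebraMap (algebraMap K (v.adicCompletion K)).injective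
  haveI : CharZero L := charZero_of_injective_algebraMap (algebraMap (v.adicCompletion K) L).injective
  haveI iDed : IsDedekindDomain (integralClosure 𝒪[v.adicCompletion K] L) := isDedekindDomain_integralClosure L
  haveI iFrac : IsFractionRing (integralClosure 𝒪[v.adicCompletion K] L) L := isFractionRing_integralClosure L
  haveI iPerf : PerfectField L := PerfectField.ofCharZero
  haveI iAlg : Algebra.IsAlgebraic L (AlgebraicClosure (v.adicCompletion K)) := Algebra.IsAlgebraic.tower_top (K := v.adicCompletion K) L
  have hh' : ∀ d, ((h d : closureValuationSubring (v.adicCompletion K)) : AlgebraicClosure (v.adicCompletion K)) =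
      algebraMap L (AlgebraicClosure (v.adicCompletion K)) (algebraMap (integralClosure 𝒪[v.adicCompletion K] L) L d) := fun d => hh d
  have ha := specGenericPoint_comp_specMap_eq_of_coe_eq (F := v.adicCompletion K) L h hh
  -- ★ (ν6)
  have H6 := exists_stage_hom_reduction 𝓨 𝒜 𝒞 x x'' _ h hh' ha z z'' hz hz'' u
  -- (witnesses for the instance slots that later types constrain are left to unification with `H6`'s type — giving them by
  --  `inferInstance` makes the final unification unfold the whole stage tower for minutes)
  exact ⟨_, _, iDed, L, _, _, iFrac, iPerf, _, iAlg, _, h, hh', hcomp, ha, z, z'', hz, hz'', H6⟩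

end AbelianSchemeOver

end Literature.AlgebraicGeometry.AbelianSchemes

end
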